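import Summits.QuantumFields.BalabanUV.T4Continuum.Spine.NE5.TwoRunTorusPrimitiveParam
import Summits.QuantumFields.BalabanUV.T4Continuum.Spine.NE5.TwoRunPrimitivePencil

/-!
# Spine/NE5/TwoRunTorusPencilData — `hPhol ∧ h226` FOR ONE TERM ALONG NE5's TWO-RUN PENCIL FROM THE TWO RUNS' PRIMITIVE
# DATA: run A's letters ∕ (2.20), the primitive-level two-run rates, the common characteristic functions, constants
# (cell `pub-balaban-gaps`, seat `ne5` gen 8)

WHY.  T21 `TwoRunTorusPrimitiveParam.hol_and_h226_torus_of_primitives_param` asks, for a family of primitives along a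
parameter, the located letters UNIFORM in the parameter; T22 `TwoRunPrimitivePencil` shows that along the AFFINE two-run
pencil `A_θ = A₀ + θ(A₁ − A₀)`, `G_θ = G₀ + θ(G₁ − G₀)`, `𝐕_θ = 𝐕₀ + θ(𝐕₁ − 𝐕₀)` those letters follow from RUN A's letters
∕ (2.20) and the PRIMITIVE-LEVEL TWO-RUN RATES.  THIS FILE composes the two for ONE term `(Z, t)` of the torus model with
`B = ℂ`, `V = ball 0 ρ`: `hol_and_h226_torus_of_two_runs`.  Its hypotheses are the builder's PER-RUN data at run A
(letters `K_G, K_{Cσ}, θ_Γ, θ_C, θ_E` at rate `κ` on the open σ-polydisc, symmetry of both runs' precisions, entrywise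
σ-holomorphy of both runs' kernels, (2.20) for `𝐕₀`, measurability), the two-run rates `r_A, r_G` (rows NE2∕NE3's W1 in
primitive currency) and `(a′, w′)` for `𝐕₁ − 𝐕₀` (the history channel), the common `χ, χᶜ, 𝐃, C, Γ₀` ((x9)), the window
`ρ`, a dropped rate `κ′ < κ` with the smallness `Kϑ < 1` of `TwoRunPrimitivePencil.inv_pencil_letters` and
`(θ_E + ρr_A)·mKc(κ)·c < 1` of `re_posDef_pencil`, MAJORANT constants `K′_G ≥ K_G + ρr_G`, … for T21's package at rate
`κ′`, and T21's numerical ∕ constant-matching conditions on those majorants.  Conclusion: T21's — the term family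
`θ ↦ term214 r lZ lD (core214 (A_θ) (Γ_θ) (F214 |P| χ χᶜ 𝐃 𝐕_θ)) 0 0` is `DifferentiableOn ℂ` on `ball 0 ρ` and obeys (2.26)
for every member: the per-term inputs `hPhol`, `h226` of T14 `TwoRunTorusRate.norm_E_sub_le_torus` (NE5 at one scale,
`ρ = s∕r_j`) ∕ T23 `TwoRunTorusPrimitivePencil.norm_E_sub_le_torus_of_primitives`.
LEDGER MEANING (row NE5): per term and configuration, NE5's formula-layer input on the periodic carrier is now a theorem
about run A's primitive data + the primitive two-run rates + the common small-field functions + constants — the per-run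
READ-OUT of NODE O's objects (gate (c)) is all that remains on the NE5 side, besides `TowerFromRecord`.

HONEST FRAMING.  Pure composition of T21 and T22 over LANDED shapes; every kernel family, rate, region and constant is a
HYPOTHESIS; nothing of Bałaban's or of the two-run rates is constructed or asserted; NE5 NOT PRINTED ∕ NOT PROVED; leaves
0∕12; (D4) 0∕1; spine 0∕9.  Rung (B)+1 on a FIXED finite T⁴ — NOT continuum, NOT infinite volume, NOT mass gap, NOT
Clay.  HONEST DEPENDENCY: continuum YM on T⁴ ⇐ BetaPertH ∧ nine spine estimates; BetaPertH ⇐ (D1) ∧ (D4) ∧ CAP+tail.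
0 sorry, 0 `def`.

Sources: [II] = T. Bałaban, CMP **116** (1988) [Balaban1988RG2Cluster] (1.5)∕(1.7) p. 3, (2.14)–(2.26) pp. 15–17;
C. King, CMP **102** (1986) [King1986] p. 665.  Nothing here is a claim about the Yang–Mills mass gap.
-/

noncomputable section

namespace Summit.QuantumFields.BalabanUV.T4Continuum.Spine.NE5.TwoRunTorusPencilData

open Matrix Metric Set Finset
open Literature.MathematicalPhysics.QuantumFieldTheory.Balaban1983to89
open Literature.MathematicalPhysics.QuantumFieldTheory.Balaban1983to89.TreeLengthTorus (TPt TDom tsys)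
open Literature.MathematicalPhysics.QuantumFieldTheory.Balaban1983to89.TreeLengthTorusTransfer (tclosure)
open Literature.MathematicalPhysics.QuantumFieldTheory.Balaban1983to89.B13Lemma3TorusData (TBond)
open Literature.MathematicalPhysics.QuantumFieldTheory.Balaban1983to89.B13Lemma3TorusTerms (weight Z0)
open Literature.MathematicalPhysics.QuantumFieldTheory.Balaban1983to89.B13Term214 (core214 F214 term214)
open Literature.MathematicalPhysics.QuantumFieldTheory.Balaban1983to89.B13Bound143 (invTau)
open Literature.MathematicalPhysics.QuantumFieldTheory.Balaban1983to89.B5TorusCover (UT)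
open Literature.MathematicalPhysics.QuantumFieldTheory.Balaban1983to89.B9Thm37GlueTorus (tdist1)
open Literature.MathematicalPhysics.QuantumFieldTheory.Balaban1983to89.B13Lemma3TorusPrimitive
  (weightHyp_tdist1 tdist1_symm kc_tdist1)
open Literature.MathematicalPhysics.QuantumFieldTheory.Balaban1983to89.B13Bound226Located (entry_bound_mono_rate)
open Summit.QuantumFields.BalabanUV.T4Continuum.Spine.NE5.TwoRunTorusPrimitiveParam
  (hol_and_h226_torus_of_primitives_param)
open Summit.QuantumFields.BalabanUV.T4Continuum.Spine.NE5.TwoRunPrimitivePencil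

variable {d L N' : ℕ} [NeZero L] [NeZero N'] {M : ℕ}
variable {ν : ℕ} {Nf : Fin ν → ℕ} [∀ i, NeZero (Nf i)]
variable {Λ : Type} [Fintype Λ] [DecidableEq Λ] {C₀ : Type} [Fintype C₀] [DecidableEq C₀]

/-- A located bound with a smaller constant and a larger rate implies the bound with a larger constant and a smaller rate
(plumbing for feeding T21's single package). [folklore] [cite: Balaban1988RG2Cluster, (2.16) p.16] -/
private theorem located_mono {x K K' κ κ' dd : ℝ} (hx : x ≤ K * Real.exp (-(κ * dd))) (hK : K ≤ K') (hK0 : 0 ≤ K')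
    (hκ : κ' ≤ κ) (hd : 0 ≤ dd) : x ≤ K' * Real.exp (-(κ' * dd)) :=
  hx.trans ((mul_le_mul_of_nonneg_right hK (Real.exp_pos _).le).trans
    (mul_le_mul_of_nonneg_left (Real.exp_le_exp.2 (neg_le_neg (mul_le_mul_of_nonneg_right hκ hd))) hK0))

open Classical in
/-- **`hPhol` ∧ `h226` FOR ONE TERM ALONG NE5's AFFINE TWO-RUN PENCIL, FROM THE TWO RUNS' PRIMITIVE DATA.**  Run A's
primitives `A₀(σ)`, `G₀(σ)`, `𝐕₀` and run B's `A₁(σ)`, `G₁(σ)`, `𝐕₁` on the SAME located bonds of the term; run A's letters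
`K_G, K_{Cσ}, θ_Γ, θ_C, θ_E` at rate `κ` against the common reference `(C, Γ₀)` on the open σ-polydisc, both runs'
precisions symmetric there, entrywise σ-holomorphy of `A₀, A₁, G₀, G₁`, run A's (2.20) `(a₀, w₀)` on `Π_Y Uτ Y` and the
DIFFERENCE bound `(a₁, w₁)` for `𝐕₁ − 𝐕₀`, measurability; the primitive TWO-RUN RATES `‖(A₁ − A₀)(σ)‖_{bb′} ≤ r_A e^{−κρ}`,
`‖(G₁ − G₀)(σ)‖_{bj} ≤ r_G e^{−κρ}`; the window `ρ ≥ 0`; a dropped rate `0 < κ′ < κ` with `Kϑ < 1` (`K = K_{Cσ}·m(1+2∕(κ−κ′))^ν`,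
`ϑ = ρr_A·m(1+2∕(κ−κ′))^ν`) and `(θ_E + ρr_A)·m(1+2∕κ)^ν·c < 1`; majorants `K′_G, K′_{Cσ}, θ′_Γ, θ′_C, θ′_E` of the pencil's
letters; and T21's remaining hypotheses (common `χ, χᶜ, 𝐃`, (2.22), rates `κ′ > κ₂ > κ₃ > 0`, `hθR1le`, `hsmallKθ`, `hαc`,
`hsmall`, `hPa`, `hvol`) stated for the majorants with (2.20)-constants `(a₀ + ρa₁, w₀ + ρw₁)`.  Conclusion: for the pencil
`A_θ = A₀ + θ(A₁ − A₀)`, `Γ_θ X = G_θ·X`, `𝐕_θ = 𝐕₀ + θ(𝐕₁ − 𝐕₀)`: the term family is `DifferentiableOn ℂ` on `ball 0 ρ` and (2.26)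
holds for every member — T21 `hol_and_h226_torus_of_primitives_param` fed by T22.
[cite: Balaban1988RG2Cluster, (1.5)∕(1.7) p.3, (2.14)–(2.26) pp.15–17; King1986, p.665] -/
theorem hol_and_h226_torus_of_two_runs (c : B13.Consts) (hκ₁ : 1 ≤ c.κ₁) (hα₆ : c.α₆ ≠ 0)
    (Z : TDom d N') (t : Finset (TDom d (L * N')) × Finset (TBond d M (L * N')))
    (hpos : ∀ Y : TDom d (L * N'), 0 < invTau c ((tsys d (L * N')).dj Y))
    (hhalf : ∀ Y : TDom d (L * N'), invTau c ((tsys d (L * N')).dj Y) ≤ 1 / 2)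
    {Uσ : Set ℂ} {Uτ : TDom d (L * N') → Set ℂ} (hUσ : IsOpen Uσ) (hUτ : ∀ Y, IsOpen (Uτ Y))
    (hUexp : closedBall (0 : ℂ) (Real.exp c.κ₁) ⊆ Uσ)
    (hUtau : ∀ Y : TDom d (L * N'), closedBall (0 : ℂ) ((invTau c ((tsys d (L * N')).dj Y))⁻¹) ⊆ Uτ Y)
    {r : ℝ} (hr : 0 < r) (hr' : r ≤ Real.exp c.κ₁ - 1)
    (hsubτ : ∀ Y, ∀ s ∈ Set.uIcc (0 : ℝ) 1, closedBall (s : ℂ) r ⊆ Uτ Y)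
    (lZ : List (TPt d N')) (hlZ : lZ.Nodup ∧ lZ.toFinset = Z.1 \ tclosure L N' (Z0 M t))
    (lD : List (TDom d (L * N'))) (hlD : lD.Nodup ∧ lD.toFinset = t.1)
    -- the two runs' primitives on the term's located bonds, the common reference and small-field data
    (A₀ A₁ : (TPt d N' → ℂ) → Matrix Λ Λ ℂ) (G₀ G₁ : (TPt d N' → ℂ) → Matrix Λ (Λ ⊕ C₀) ℂ)
    (V₀ V₁ : TDom d (L * N') → (Λ → ℝ) → ℂ)
    (χY₀ χcP : (Λ → ℝ) → ℝ) (hχ0 : ∀ Bf, 0 ≤ χY₀ Bf) (hχc0 : ∀ Bf, 0 ≤ χcP Bf) (Dfam : Finset (TDom d (L * N')))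
    {C : Matrix Λ Λ ℝ} (hC : C.PosDef) (Γ₀ : Matrix Λ (Λ ⊕ C₀) ℝ)
    (locΛ : Λ → UT Nf) (locN : Λ ⊕ C₀ → UT Nf) {m : ℕ}
    (hfibΛ : ∀ x : UT Nf, (Finset.univ.filter fun i => locΛ i = x).card ≤ m)
    (hfibN : ∀ x : UT Nf, (Finset.univ.filter fun j => locN j = x).card ≤ m)
    -- regularity of both runs' kernels; measurability
    (hA₀hol : ∀ i j, DifferentiableOn ℂ (fun σ => A₀ σ i j) {σ | ∀ j, σ j ∈ Uσ})
    (hA₁hol : ∀ i j, DifferentiableOn ℂ (fun σ => A₁ σ i j) {σ | ∀ j, σ j ∈ Uσ})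
    (hG₀hol : ∀ i j, DifferentiableOn ℂ (fun σ => G₀ σ i j) {σ | ∀ j, σ j ∈ Uσ})
    (hG₁hol : ∀ i j, DifferentiableOn ℂ (fun σ => G₁ σ i j) {σ | ∀ j, σ j ∈ Uσ})
    (hχm : Measurable χY₀) (hχcm : Measurable χcP) (hV₀m : ∀ Y, Measurable (V₀ Y)) (hV₁m : ∀ Y, Measurable (V₁ Y))
    (hA₀s : ∀ σ : TPt d N' → ℂ, (∀ j, σ j ∈ Uσ) → (A₀ σ).IsSymm)
    (hA₁s : ∀ σ : TPt d N' → ℂ, (∀ j, σ j ∈ Uσ) → (A₁ σ).IsSymm)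
    -- run A's located letters at rate κ, the primitive two-run rates, the window
    {κ KG KCs θΓ θC θE rA rG ρ : ℝ} (hκ : 0 < κ) (hKG : 0 ≤ KG) (hKCs : 0 ≤ KCs) (hθΓ : 0 ≤ θΓ) (hθC : 0 ≤ θC)
    (hθE : 0 ≤ θE) (hrA : 0 ≤ rA) (hrG : 0 ≤ rG) (hρ0 : 0 ≤ ρ)
    (hG0 : ∀ σ : TPt d N' → ℂ, (∀ j, σ j ∈ Uσ) →
      ∀ i j, ‖G₀ σ i j‖ ≤ KG * Real.exp (-(κ * tdist1 Nf (locΛ i) (locN j))))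
    (hCs0 : ∀ σ : TPt d N' → ℂ, (∀ j, σ j ∈ Uσ) →
      ∀ i i', ‖(A₀ σ)⁻¹ i i'‖ ≤ KCs * Real.exp (-(κ * tdist1 Nf (locΛ i) (locΛ i'))))
    (hdΓ0 : ∀ σ : TPt d N' → ℂ, (∀ j, σ j ∈ Uσ) →
      ∀ i j, ‖(G₀ σ - Γ₀.map (algebraMap ℝ ℂ)) i j‖ ≤ θΓ * Real.exp (-(κ * tdist1 Nf (locΛ i) (locN j))))
    (hdC0 : ∀ σ : TPt d N' → ℂ, (∀ j, σ j ∈ Uσ) →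
      ∀ i i', ‖((A₀ σ)⁻¹ - C.map (algebraMap ℝ ℂ)) i i'‖ ≤ θC * Real.exp (-(κ * tdist1 Nf (locΛ i) (locΛ i'))))
    (hdE0 : ∀ σ : TPt d N' → ℂ, (∀ j, σ j ∈ Uσ) →
      ∀ i i', ‖(A₀ σ - C⁻¹.map (algebraMap ℝ ℂ)) i i'‖ ≤ θE * Real.exp (-(κ * tdist1 Nf (locΛ i) (locΛ i'))))
    (hA10 : ∀ σ : TPt d N' → ℂ, (∀ j, σ j ∈ Uσ) →
      ∀ i i', ‖(A₁ σ - A₀ σ) i i'‖ ≤ rA * Real.exp (-(κ * tdist1 Nf (locΛ i) (locΛ i'))))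
    (hG10 : ∀ σ : TPt d N' → ℂ, (∀ j, σ j ∈ Uσ) →
      ∀ i j, ‖(G₁ σ - G₀ σ) i j‖ ≤ rG * Real.exp (-(κ * tdist1 Nf (locΛ i) (locN j))))
    -- run A's (2.20) and the two-run rate of the potentials, (2.22) for the common small-field functions
    {γ₂ rP a0 w0 a1 w1 : ℝ} (qP : (Λ → ℝ) → ℝ)
    (h222 : ∀ Bf, χY₀ Bf * χcP Bf ≤ Real.exp (-(γ₂ / 2 * rP ^ 2 * (t.2.card : ℕ)) + γ₂ / 2 * qP Bf))
    (hγ₂ : 0 ≤ γ₂) (hqP : ∀ Bf, qP Bf ≤ Bf ⬝ᵥ Bf) (ha0 : 0 ≤ a0) (ha1 : 0 ≤ a1)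
    (h220A : ∀ τ : TDom d (L * N') → ℂ, (∀ Y, τ Y ∈ Uτ Y) →
      ∀ Bf, ∑ Y ∈ Dfam, ‖τ Y‖ * ‖V₀ Y Bf‖ ≤ a0 / 2 * (Bf ⬝ᵥ Bf) + w0)
    (h220D : ∀ τ : TDom d (L * N') → ℂ, (∀ Y, τ Y ∈ Uτ Y) →
      ∀ Bf, ∑ Y ∈ Dfam, ‖τ Y‖ * ‖V₁ Y Bf - V₀ Y Bf‖ ≤ a1 / 2 * (Bf ⬝ᵥ Bf) + w1)
    -- the dropped rate and the two smallness conditions of the pencil lemmas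
    {κ' c₀ : ℝ} (hκ' : 0 < κ') (hκ'κ : κ' < κ)
    (hwin : KCs * (m * (1 + 2 / (κ - κ')) ^ ν) * (ρ * rA * (m * (1 + 2 / (κ - κ')) ^ ν)) < 1)
    (hc₀ : ∀ k, hC.1.eigenvalues k ≤ c₀) (hre : (θE + ρ * rA) * (m * (1 + 2 / κ) ^ ν) * c₀ < 1)
    -- majorants of the pencil's letters (T21's package constants at rate κ′)
    {KG' KCs' θΓ' θC' θE' : ℝ} (hKG' : KG + ρ * rG ≤ KG')
    (hKCs' : (1 - KCs * (m * (1 + 2 / (κ - κ')) ^ ν) * (ρ * rA * (m * (1 + 2 / (κ - κ')) ^ ν)))⁻¹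
      * (KCs * (m * (1 + 2 / (κ - κ')) ^ ν)) ≤ KCs')
    (hθΓ' : θΓ + ρ * rG ≤ θΓ')
    (hθC' : KCs * (m * (1 + 2 / (κ - κ')) ^ ν) * (ρ * rA * (m * (1 + 2 / (κ - κ')) ^ ν))
      * (1 - KCs * (m * (1 + 2 / (κ - κ')) ^ ν) * (ρ * rA * (m * (1 + 2 / (κ - κ')) ^ ν)))⁻¹
      * (KCs * (m * (1 + 2 / (κ - κ')) ^ ν)) + θC ≤ θC')
    (hθE' : θE + ρ * rA ≤ θE')
    -- T21's package at rate κ′ for the majorants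
    {kap' kap'' θ KΓ K₀ : ℝ} (hkap'' : 0 < kap'') (h1 : kap'' < kap') (h2 : kap' < κ')
    (hKΓ : 0 ≤ KΓ) (hK₀ : 0 ≤ K₀) (hθEle : θE' ≤ θ) (hθΓle : θΓ' ≤ θ)
    (hθR1le : (m * (1 + 2 / (κ' - kap')) ^ ν) * (m * (1 + 2 / (kap' - kap'')) ^ ν)
      * (θΓ' * KCs' * KG' + KΓ * θC' * KG' + KΓ * K₀ * θΓ') ≤ θ)
    (hΓ₀ : ∀ i j, ‖Γ₀ i j‖ ≤ KΓ * Real.exp (-(κ' * tdist1 Nf (locΛ i) (locN j))))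
    (hC216 : ∀ i i', ‖C i i'‖ ≤ K₀ * Real.exp (-(κ' * tdist1 Nf (locΛ i) (locΛ i'))))
    (hsmallKθ : K₀ * (m * (1 + 2 / κ') ^ ν) * (θ * (m * (1 + 2 / kap'') ^ ν)) < 1)
    {g : ℝ} (hc0' : 0 ≤ c₀)
    (hαc : (2 * (θ * (m * (1 + 2 / kap'') ^ ν)) + (γ₂ + (a0 + ρ * a1))) * c₀ ≤ 1 / 2) (hg : 0 ≤ g)
    (hΓq : ∀ X : Λ ⊕ C₀ → ℝ, (Γ₀ *ᵥ X) ⬝ᵥ (C *ᵥ (Γ₀ *ᵥ X)) ≤ g * (X ⬝ᵥ X))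
    (hsmall : (2 * (θ * (m * (1 + 2 / kap'') ^ ν)) + (γ₂ + (a0 + ρ * a1))) * (1 + 2 * c₀ * g) ≤ 1 / 2)
    {a a₅ : ℝ} (hPa : a ≤ γ₂ * rP ^ 2)
    (hvol : 2 * (K₀ * (m * (1 + 2 / κ') ^ ν) * (θ * (m * (1 + 2 / kap'') ^ ν))
              * (1 + (1 - K₀ * (m * (1 + 2 / κ') ^ ν) * (θ * (m * (1 + 2 / kap'') ^ ν)))⁻¹) / 2)
          * (Fintype.card Λ : ℝ)
        + (w0 + ρ * w1) + (2 * (θ * (m * (1 + 2 / kap'') ^ ν)) + (γ₂ + (a0 + ρ * a1))) * c₀ * (Fintype.card Λ : ℝ)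
        + (2 * (θ * (m * (1 + 2 / kap'') ^ ν)) + (γ₂ + (a0 + ρ * a1))) * (1 + 2 * c₀ * g)
          * (Fintype.card (Λ ⊕ C₀) : ℝ)
        ≤ a₅ * ((Z.1).card : ℝ)) :
    DifferentiableOn ℂ
        (fun b : ℂ => term214 r lZ lD (core214 (fun σ => A₀ σ + b • (A₁ σ - A₀ σ))
          (fun σ X => (G₀ σ + b • (G₁ σ - G₀ σ)) *ᵥ fun j => (X j : ℂ))
          (F214 t.2.card χY₀ χcP Dfam (fun Y Bf => V₀ Y Bf + b * (V₁ Y Bf - V₀ Y Bf)))) 0 0) (ball (0 : ℂ) ρ) ∧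
      ∀ b ∈ ball (0 : ℂ) ρ, ‖term214 r lZ lD (core214 (fun σ => A₀ σ + b • (A₁ σ - A₀ σ))
          (fun σ X => (G₀ σ + b • (G₁ σ - G₀ σ)) *ᵥ fun j => (X j : ℂ))
          (F214 t.2.card χY₀ χcP Dfam (fun Y Bf => V₀ Y Bf + b * (V₁ Y Bf - V₀ Y Bf)))) 0 0‖ ≤
        weight L M c Z a t * Real.exp (a₅ * ((Z.1).card : ℝ)) := by
  -- the located data of the site torus
  have hρd : B13PerturbativeStep.WeightHyp 0 (tdist1 Nf) := weightHyp_tdist1 (N := Nf)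
  have hd0 : ∀ x y : UT Nf, 0 ≤ tdist1 Nf x y := hρd.nonneg
  have hb : ∀ b ∈ ball (0 : ℂ) ρ, ‖b‖ ≤ ρ := fun b hb => (mem_ball_zero_iff.1 hb).le
  -- non-negativity of the majorants
  have hKG'0 : 0 ≤ KG' := (add_nonneg hKG (mul_nonneg hρ0 hrG)).trans hKG'
  have hθΓ'0 : 0 ≤ θΓ' := (add_nonneg hθΓ (mul_nonneg hρ0 hrG)).trans hθΓ'
  have hθE'0 : 0 ≤ θE' := (add_nonneg hθE (mul_nonneg hρ0 hrA)).trans hθE'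
  have hK0 : 0 ≤ KCs * (m * (1 + 2 / (κ - κ')) ^ ν) := mul_nonneg hKCs (by positivity)
  have hϑ0 : 0 ≤ ρ * rA * (m * (1 + 2 / (κ - κ')) ^ ν) := mul_nonneg (mul_nonneg hρ0 hrA) (by positivity)
  have hinv0 : 0 ≤ (1 - KCs * (m * (1 + 2 / (κ - κ')) ^ ν) * (ρ * rA * (m * (1 + 2 / (κ - κ')) ^ ν)))⁻¹ :=
    inv_nonneg.2 (by linarith)
  have hKCs'0 : 0 ≤ KCs' := (mul_nonneg hinv0 hK0).trans hKCs'
  have hθC'0 : 0 ≤ θC' := (add_nonneg (mul_nonneg (mul_nonneg (mul_nonneg hK0 hϑ0) hinv0) hK0) hθC).trans hθC'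
  -- the inverse along the pencil (T22 §2), at each admissible σ and member b
  have hinv : ∀ b ∈ ball (0 : ℂ) ρ, ∀ σ : TPt d N' → ℂ, (∀ j, σ j ∈ Uσ) →
      IsUnit (A₀ σ + b • (A₁ σ - A₀ σ)) ∧
        (∀ i i', ‖(A₀ σ + b • (A₁ σ - A₀ σ))⁻¹ i i'‖ ≤
          (1 - KCs * (m * (1 + 2 / (κ - κ')) ^ ν) * (ρ * rA * (m * (1 + 2 / (κ - κ')) ^ ν)))⁻¹
            * (KCs * (m * (1 + 2 / (κ - κ')) ^ ν)) * Real.exp (-(κ' * tdist1 Nf (locΛ i) (locΛ i')))) ∧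
        (∀ i i', ‖((A₀ σ + b • (A₁ σ - A₀ σ))⁻¹ - C.map (algebraMap ℝ ℂ)) i i'‖ ≤
          (KCs * (m * (1 + 2 / (κ - κ')) ^ ν) * (ρ * rA * (m * (1 + 2 / (κ - κ')) ^ ν))
              * (1 - KCs * (m * (1 + 2 / (κ - κ')) ^ ν) * (ρ * rA * (m * (1 + 2 / (κ - κ')) ^ ν)))⁻¹
              * (KCs * (m * (1 + 2 / (κ - κ')) ^ ν)) + θC)
            * Real.exp (-(κ' * tdist1 Nf (locΛ i) (locΛ i')))) := by
    intro b hb' σ hσ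
    have hX : 0 ≤ (m : ℝ) * (1 + 2 / κ) ^ ν := by positivity
    have hle : θE * (m * (1 + 2 / κ) ^ ν) * c₀ ≤ (θE + ρ * rA) * (m * (1 + 2 / κ) ^ ν) * c₀ :=
      mul_le_mul_of_nonneg_right (mul_le_mul_of_nonneg_right (le_add_of_nonneg_right (mul_nonneg hρ0 hrA)) hX) hc0'
    have hre0 : ((A₀ σ).map Complex.re).PosDef :=
      re_posDef_of_letter hρd tdist1_symm kc_tdist1 hC (hA₀s σ hσ) hθE hκ locΛ hfibΛ (hdE0 σ hσ) hc₀
        (lt_of_le_of_lt hle hre)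
    exact inv_pencil_letters hρd kc_tdist1 (hA₀s σ hσ) hre0 hKCs hθC hrA hρ0 hκ'.le hκ'κ locΛ hfibΛ (hCs0 σ hσ)
      (hdC0 σ hσ) (hA10 σ hσ) hwin (hb b hb')
  -- the T21-shaped hypotheses along the pencil, one by one (explicit types keep the elaboration local)
  have hGp : ∀ b ∈ ball (0 : ℂ) ρ, ∀ σ : TPt d N' → ℂ, (∀ j, σ j ∈ Uσ) →
      ∀ i j, ‖(G₀ σ + b • (G₁ σ - G₀ σ)) i j‖ ≤ KG' * Real.exp (-(κ' * tdist1 Nf (locΛ i) (locN j))) :=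
    fun b hb' σ hσ i j => located_mono (norm_pencil_apply_le
      (w := fun i j => Real.exp (-(κ * tdist1 Nf (locΛ i) (locN j)))) (hb b hb') (hG0 σ hσ) (hG10 σ hσ) i j)
      hKG' hKG'0 hκ'κ.le (hd0 _ _)
  have hCsp : ∀ b ∈ ball (0 : ℂ) ρ, ∀ σ : TPt d N' → ℂ, (∀ j, σ j ∈ Uσ) →
      ∀ i i', ‖(A₀ σ + b • (A₁ σ - A₀ σ))⁻¹ i i'‖ ≤ KCs' * Real.exp (-(κ' * tdist1 Nf (locΛ i) (locΛ i'))) :=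
    fun b hb' σ hσ i i' => located_mono ((hinv b hb' σ hσ).2.1 i i') hKCs' hKCs'0 le_rfl (hd0 _ _)
  have hdΓp : ∀ b ∈ ball (0 : ℂ) ρ, ∀ σ : TPt d N' → ℂ, (∀ j, σ j ∈ Uσ) →
      ∀ i j, ‖(G₀ σ + b • (G₁ σ - G₀ σ) - Γ₀.map (algebraMap ℝ ℂ)) i j‖
        ≤ θΓ' * Real.exp (-(κ' * tdist1 Nf (locΛ i) (locN j))) :=
    fun b hb' σ hσ i j => located_mono (norm_pencil_sub_apply_le
      (w := fun i j => Real.exp (-(κ * tdist1 Nf (locΛ i) (locN j)))) (hb b hb') (hdΓ0 σ hσ) (hG10 σ hσ) i j)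
      hθΓ' hθΓ'0 hκ'κ.le (hd0 _ _)
  have hdCp : ∀ b ∈ ball (0 : ℂ) ρ, ∀ σ : TPt d N' → ℂ, (∀ j, σ j ∈ Uσ) →
      ∀ i i', ‖((A₀ σ + b • (A₁ σ - A₀ σ))⁻¹ - C.map (algebraMap ℝ ℂ)) i i'‖
        ≤ θC' * Real.exp (-(κ' * tdist1 Nf (locΛ i) (locΛ i'))) :=
    fun b hb' σ hσ i i' => located_mono ((hinv b hb' σ hσ).2.2 i i') hθC' hθC'0 le_rfl (hd0 _ _)
  have hdEp : ∀ b ∈ ball (0 : ℂ) ρ, ∀ σ : TPt d N' → ℂ, (∀ j, σ j ∈ Uσ) →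
      ∀ i i', ‖(A₀ σ + b • (A₁ σ - A₀ σ) - C⁻¹.map (algebraMap ℝ ℂ)) i i'‖
        ≤ θE' * Real.exp (-(κ' * tdist1 Nf (locΛ i) (locΛ i'))) :=
    fun b hb' σ hσ i i' => located_mono (norm_pencil_sub_apply_le
      (w := fun i i' => Real.exp (-(κ * tdist1 Nf (locΛ i) (locΛ i')))) (hb b hb') (hdE0 σ hσ) (hA10 σ hσ) i i')
      hθE' hθE'0 hκ'κ.le (hd0 _ _)
  have hAp : ∀ b ∈ ball (0 : ℂ) ρ, ∀ σ : TPt d N' → ℂ, (∀ j, σ j ∈ Uσ) →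
      ((A₀ σ + b • (A₁ σ - A₀ σ)).map Complex.re).PosDef :=
    fun b hb' σ hσ => re_posDef_pencil hρd tdist1_symm kc_tdist1 hC (hA₀s σ hσ) (hA₁s σ hσ) hθE hrA hρ0 hκ locΛ
      hfibΛ (hdE0 σ hσ) (hA10 σ hσ) hc₀ hre (hb b hb')
  have h220p : ∀ b ∈ ball (0 : ℂ) ρ, ∀ τ : TDom d (L * N') → ℂ, (∀ Y, τ Y ∈ Uτ Y) →
      ∀ Bf, ∑ Y ∈ Dfam, ‖τ Y‖ * ‖V₀ Y Bf + b * (V₁ Y Bf - V₀ Y Bf)‖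
        ≤ (a0 + ρ * a1) / 2 * (Bf ⬝ᵥ Bf) + (w0 + ρ * w1) :=
    fun b hb' τ hτ Bf => h220_pencil (hb b hb') hρ0 Bf (h220A τ hτ Bf) (h220D τ hτ Bf)
  exact hol_and_h226_torus_of_primitives_param c hκ₁ hα₆ Z t hpos hhalf hUσ hUτ hUexp hUtau hr hr' hsubτ lZ hlZ
    lD hlD (V := ball (0 : ℂ) ρ) isOpen_ball (fun b σ => A₀ σ + b • (A₁ σ - A₀ σ))
    (fun b σ X => (G₀ σ + b • (G₁ σ - G₀ σ)) *ᵥ fun j => (X j : ℂ)) (fun b σ => G₀ σ + b • (G₁ σ - G₀ σ)) χY₀ χcP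
    hχ0 hχc0 Dfam (fun b Y Bf => V₀ Y Bf + b * (V₁ Y Bf - V₀ Y Bf)) hC Γ₀
    (fun b _ i j => differentiableOn_pencil_sigma_apply b i j (hA₀hol i j) (hA₁hol i j))
    (fun b _ i j => differentiableOn_pencil_sigma_apply b i j (hG₀hol i j) (hG₁hol i j))
    (fun σ _ i j => differentiableOn_pencil_param_apply A₀ A₁ σ _ i j)
    (fun σ _ i j => differentiableOn_pencil_param_apply G₀ G₁ σ _ i j)
    (fun Y Bf => differentiableOn_potential_pencil V₀ V₁ Y Bf _) hχm hχcm
    (fun b _ Y => measurable_potential_pencil b Y (hV₀m Y) (hV₁m Y))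
    (fun b _ σ hσ => isSymm_pencil (hA₀s σ hσ) (hA₁s σ hσ) b) hAp
    (fun b _ σ _ X => rfl) (γ₂ := γ₂) (rP := rP) (a₂₀ := a0 + ρ * a1) (w := w0 + ρ * w1) qP h222 hγ₂ hqP
    (add_nonneg ha0 (mul_nonneg hρ0 ha1)) h220p locΛ locN hfibΛ hfibN (kap := κ') (kap' := kap') (kap'' := kap'')
    (θ := θ) (θE := θE') (θΓ := θΓ') (θC := θC') (KG := KG') (KΓ := KΓ) (KCs := KCs') (K₀ := K₀)
    hkap'' h1 h2 hθE'0 hθΓ'0 hθC'0 hKG'0 hKΓ hKCs'0 hK₀ hθEle hθΓle hθR1le hGp hΓ₀ hCsp hC216 hdΓp hdCp hdEp hsmallKθ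
    (cE := c₀) (g := g) hc0' hc₀ hαc hg hΓq hsmall (a := a) (a₅ := a₅) hPa hvol

end Summit.QuantumFields.BalabanUV.T4Continuum.Spine.NE5.TwoRunTorusPencilData

end
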